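import Summits.QuantumFields.BalabanUV.Beta.EriceRemainderEnclosureHistoryAutonomyComparisonAgeCompositionTwoAgesFar

/-!
# EriceRemainderEnclosureHistoryAutonomyComparisonAgeCompositionNestedReads — (E92a) route (N), first order: NESTED SLOW READS — THE FIRST THREE-AGE END
# BEYOND THE MASS CAP WITH NO DISPLAYED MARGIN.  The mechanism of (E91b) in RESIDUAL FORM («every target carries the reads OLDER than its reader») can be
# NESTED: for a profile carried by three ages `i < j < k`, the targets of the middle age carry the old read, so `e − O − M ≥ [(1−x_j)(1−x_k) − 4(j∕k)x_jx_k]·e`,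
# and the young target carries both, so `ε ≥ (1−x_i)(e − O − M) − 4i·x_i·(x_j∕j + x_k∕k)·e`; with every load `≤ √2∕2` this is `≥ [(1−√2∕2)³ −
# (1−√2∕2)·2j∕k − 2i∕j − 2i∕k]·e ≥ 0` as soon as `80·(ik + ij) + 24·j² ≤ j·k` (e.g. `j ≥ 100i`, `k ≥ 125j`; `j ≥ 200i`, `k ≥ 42j`; `j → ∞`: `k ≥ 24j`):
# the END `0 ≤ ε ≤ e` along EVERY admissible flow, every horizon, every damping of the self-consistent class — a HIERARCHICAL wedge `i ≪ j ≪ k` with NO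
# census letter left (the wedges R1∕R2 of (E91c) display a load margin), where the total load may exceed `1` and no pair bound is available (ratios `> 133`)

Cell `pub-balaban`, β-function sub-cell, BINDER row D4 «RemainderConst leaves for Bałaban's split» (`HOME/BINDER-OWNERS.md`; owner lineage `b2b-balaban-beta-an4`;
this file by co-owner #2 lineage `b2b-balaban-beta-d4-p2`, generation 83), β-FLOW TEAM duty (1), FREEZE (0) honoured (def-free; nothing restated).

HONEST FRAMING (page 1, verbatim and binding).  *"Discharging BetaPertH makes Bałaban's UV stability UNCONDITIONAL — a real constructive-QFT result; it is
NOT the continuum limit and NOT the Clay problem."*  THIS FILE DISCHARGES NOTHING OF THE KIND.  Elementary real algebra ∕ real analysis about ABSTRACT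
functionals on a box ]0,γ]^ℕ with displayed floors, profiles and signs, and the FIRST-ORDER renewal objects of route (N) built from them — hypotheses of a
census, not facts; the form, signs, ages and moments of Bałaban's (1.22) limit functional are NOT PRINTED ([I] p. 298; GAPS G-t4-U2-1∕-2) and NOT asserted.
Row D4 class UNCHANGED (critical-path width 0; instance 0∕1; D4 DISCHARGE NO DATE).  HONEST DEPENDENCY: continuum YM on T⁴ ⇐ BetaPertH ∧ nine spine
estimates (0/9 proved); BetaPertH ⇐ (D1) ∧ (D4) ∧ CAP+tail; G-an2-4 gates asym, D1 and NE2/3/4.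

THE POINT (README `HOME/b2b-balaban-beta-d4-p2/g83/e92/README.md`).  (E91b) proves the two-age END at every ratio from ONE contraction: the young targets
carry the old read.  README g82∕e91 §2(c) records why ONE contraction cannot reach three ages at every ratio (the pair margins vanish at ratio 133) and
leaves the wedges R1∕R2 with DISPLAYED load margins.  Here the contraction is written in RESIDUAL FORM — §1 `residual_step`: at one pin, from the bounds
beyond it, a young read with rows `≤ sy` against ANY older read `O` with `e − O ≥ 0` and variation `O(m) − O(m+d) ≤ V·e_m` over the young window gives
`e − O − Y ≥ (1 − sy)(e − O) − sy·V·e` — so that its OUTPUT is again a residual and the step NESTS along a chain of ages.  For three ages the old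
residual is `1 − x_k`, the middle one `(1−x_j)(1−x_k) − x_j·4j·c_k` ((E91a) `old_read_variation` over `d ≤ j` pins), the young one
`(1−x_i)·[…] − x_i·4i·(c_j + c_k)` (both older reads vary slowly over `d ≤ i` pins); every load is `≤ √2∕2` ((E82a) `row_mass_le`, (E89b)
`window_load_le_sqrt_two_div_two`) and `√2 ≤ 99∕70` serves `(1 − √2∕2)³ ≥ 1∕40`, `12(1−√2∕2)² ≥ 1`.  Uses (E91a) `old_read_variation`, (E82a)
`kernel_entry_le`∕`row_mass_le`, (E89b) `window_load_le_sqrt_two_div_two`, (E80b) `aggregate_eq_sum` BY NAME.  NOT CLAIMED: three ages outside the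
hierarchical wedge (README g83∕e92 §2: R0 `k₃ ≤ 56`, R1∕R2 with displayed margins, the bounded gap); four or more ages (the nested residual loses a factor
`1 − √2∕2` per level); anything printed — NOT B12 Thm 2, NOT BetaPertH.

WHAT IS PROVED ([folklore]; 0 `def`, 0 sorry).  §1 (pure) `renewal_bounds_of_step` (downward induction from the horizon), **`residual_step`** (one pin,
residual in, residual out), `nested_numerics`.  §2 **`flow_nonneg_three_ages_nested`** (ages `i < j < k`, `80(ik + ij) + 24j² ≤ jk`),
**`flow_nonneg_census_three_ages_nested`** (`{1, k₂, k₃}`, `80(k₂ + k₃) + 24k₂² ≤ k₂k₃`).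
-/
noncomputable section
open Finset

namespace Summit.QuantumFields.BalabanUV.Beta.EriceRemainderEnclosureHistoryAutonomyComparisonAgeCompositionNestedReads

open Literature.MathematicalPhysics.QuantumFieldTheory.Balaban1983to89
open Literature.MathematicalPhysics.QuantumFieldTheory.Balaban1983to89.T4BetaStationary
open Literature.MathematicalPhysics.QuantumFieldTheory.Balaban1983to89.T4BetaFlowWellPosed
open Summit.QuantumFields.BalabanUV.Beta.EriceRemainderEnclosureHistoryAutonomyComparisonAgeCompositionTwoAgesOldRead (old_read_variation)
open Summit.QuantumFields.BalabanUV.Beta.EriceRemainderEnclosureHistoryAutonomyComparisonAgeCompositionThreeAgesMassCap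
  (window_load_le_sqrt_two_div_two)
open Summit.QuantumFields.BalabanUV.Beta.EriceRemainderEnclosureHistoryAutonomyComparisonAgeCompositionYoungestTailSumFlow
  (kernel_entry_le row_mass_le)
open Summit.QuantumFields.BalabanUV.Beta.EriceRemainderEnclosureHistoryAutonomyComparisonAgeCompositionChainWiring (aggregate_eq_sum)

variable {B : (ℕ → ℝ) → ℝ} {γ b gIR : ℝ} {L : ℕ → ℝ} {K : ℕ} {h g : ℕ → ℝ}

/-! ## §1 The pure mechanism in residual form -/

/-- **DOWNWARD INDUCTION FROM THE HORIZON (pure).**  If `ε = 0` beyond `N`, `e ≥ 0`, and at every pin the bounds `0 ≤ ε ≤ e` BEYOND the pin give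
them AT the pin, then `0 ≤ ε ≤ e` everywhere. [folklore] -/
theorem renewal_bounds_of_step {N : ℕ} {e ε : ℕ → ℝ} (he0 : ∀ m, 0 ≤ e m) (hεt : ∀ m, N < m → ε m = 0)
    (step : ∀ m, (∀ q, m < q → 0 ≤ ε q ∧ ε q ≤ e q) → 0 ≤ ε m ∧ ε m ≤ e m) : ∀ m, 0 ≤ ε m ∧ ε m ≤ e m := by
  have main : ∀ n m, N < m + n → 0 ≤ ε m ∧ ε m ≤ e m := by
    intro n
    induction n with
    | zero => intro m hm; rw [hεt m (by omega)]; exact ⟨le_rfl, he0 m⟩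
    | succ n ih => intro m hm; exact step m fun q hq => ih q (by omega)
  exact fun m => main (N + 1) m (by omega)

/-- **THE RESIDUAL STEP (pure, one pin): A YOUNG CONTRACTION AGAINST ANY OLDER READ — RESIDUAL IN, RESIDUAL OUT.**  At the pin `m`: the young read
`Y = Σ_l wy_l·ε_{m+1+l}` has non-negative weights vanishing for `l ≥ i` and row sum `≤ sy`; every target carries the older read, `ε_q ≤ e_q − O_q`
(`q > m`); the older read leaves a non-negative residual at the pin, `e_m − O_m ≥ 0`, and varies slowly across the young window, `O_m − O_{m+d} ≤ V·e_m`
(`1 ≤ d ≤ i`, `V ≥ 0`); `e ≥ 0` non-increasing.  Then `e_m − O_m − Y ≥ (1 − sy)·(e_m − O_m) − sy·V·e_m`. [folklore] -/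
theorem residual_step {i Kw m : ℕ} {sy V : ℝ} {wy : ℕ → ℝ} {O e ε : ℕ → ℝ}
    (hwy0 : ∀ l, 0 ≤ wy l) (hwyi : ∀ l, i ≤ l → wy l = 0) (hWy : ∑ l ∈ range Kw, wy l ≤ sy) (hV : 0 ≤ V)
    (he0 : ∀ m, 0 ≤ e m) (hea : ∀ m, e (m + 1) ≤ e m)
    (htarget : ∀ q, m < q → ε q ≤ e q - O q) (hres : 0 ≤ e m - O m)
    (hvar : ∀ d, 1 ≤ d → d ≤ i → O m - O (m + d) ≤ V * e m) :
    (1 - sy) * (e m - O m) - sy * V * e m ≤ e m - O m - ∑ l ∈ range Kw, wy l * ε (m + 1 + l) := by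
  have hea' : ∀ p q, p ≤ q → e q ≤ e p := by
    intro p q hpq
    induction q, hpq using Nat.le_induction with
    | base => exact le_rfl
    | succ q _ ih => exact (hea q).trans ih
  set Wy := ∑ l ∈ range Kw, wy l with hWy_def
  have hWy0 : 0 ≤ Wy := sum_nonneg fun l _ => hwy0 l
  -- the young targets carry the older read
  have hYle : ∑ l ∈ range Kw, wy l * ε (m + 1 + l) ≤ Wy * e m - ∑ l ∈ range Kw, wy l * O (m + 1 + l) := by
    rw [hWy_def, sum_mul, ← sum_sub_distrib]
    refine sum_le_sum fun l _ => ?_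
    by_cases hl : l < i
    · have h1 := htarget (m + 1 + l) (by omega)
      have h2 := hea' m (m + 1 + l) (by omega)
      have h3 := hwy0 l
      nlinarith
    · rw [hwyi l (not_lt.mp hl)]; simp
  -- the older read varies slowly across the young window
  have hvar' : ∑ l ∈ range Kw, wy l * (O m - O (m + 1 + l)) ≤ Wy * (V * e m) := by
    rw [hWy_def, sum_mul]
    refine sum_le_sum fun l _ => ?_
    by_cases hl : l < i
    · have := hvar (l + 1) (by omega) (by omega)
      rw [show m + 1 + l = m + (l + 1) by ring]
      exact mul_le_mul_of_nonneg_left this (hwy0 l)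
    · rw [hwyi l (not_lt.mp hl)]; simp
  have hsum : ∑ l ∈ range Kw, wy l * O (m + 1 + l) = Wy * O m - ∑ l ∈ range Kw, wy l * (O m - O (m + 1 + l)) := by
    rw [hWy_def, sum_mul, ← sum_sub_distrib]
    exact sum_congr rfl fun l _ => by ring
  have key : (1 - Wy) * (e m - O m) - Wy * (V * e m) ≤ e m - O m - ∑ l ∈ range Kw, wy l * ε (m + 1 + l) := by
    linarith [hYle, hvar', hsum]
  -- (1 − Wy)(e − O) − Wy·V·e ≥ (1 − sy)(e − O) − sy·V·e since Wy ≤ sy, e − O ≥ 0, V·e ≥ 0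
  have h1 : (1 - sy) * (e m - O m) ≤ (1 - Wy) * (e m - O m) := mul_le_mul_of_nonneg_right (by linarith) hres
  have h2 : Wy * (V * e m) ≤ sy * (V * e m) := mul_le_mul_of_nonneg_right hWy (mul_nonneg hV (he0 m))
  linarith

/-- **THE NUMERICS OF THE HIERARCHICAL WEDGE.**  `80(ik + ij) + 24j² ≤ jk` with `i, j, k > 0` gives
`0 ≤ (1 − √2∕2)³ − (1 − √2∕2)·(2j∕k) − 2i∕j − 2i∕k` (`√2 ≤ 99∕70`: `(41∕140)³·80 ≥ 2`, `(41∕140)²·12 ≥ 1`). [folklore] -/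
theorem nested_numerics {i j k : ℕ} (hi : 0 < i) (hj : 0 < j) (hk : 0 < k) (hcond : 80 * (i * k + i * j) + 24 * j * j ≤ j * k) :
    0 ≤ (1 - Real.sqrt 2 / 2) ^ 3 - (1 - Real.sqrt 2 / 2) * (2 * (j : ℝ) / k) - 2 * (i : ℝ) / j - 2 * (i : ℝ) / k := by
  have hs99 : Real.sqrt 2 ≤ 99 / 70 := Real.sqrt_le_iff.mpr ⟨by norm_num, by norm_num⟩
  have hs1 : (1 : ℝ) ≤ Real.sqrt 2 := by rw [Real.le_sqrt (by norm_num) (by norm_num)]; norm_num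
  have hir : (0 : ℝ) < i := by exact_mod_cast hi
  have hjr : (0 : ℝ) < j := by exact_mod_cast hj
  have hkr : (0 : ℝ) < k := by exact_mod_cast hk
  have hc : (80 : ℝ) * (i * k + i * j) + 24 * j * j ≤ j * k := by exact_mod_cast hcond
  set c : ℝ := 1 - Real.sqrt 2 / 2 with hc_def
  have hc0 : (41 : ℝ) / 140 ≤ c := by rw [hc_def]; linarith
  have hc1 : c ≤ 1 / 2 := by rw [hc_def]; linarith
  -- 2j∕k ≤ 1∕12 ≤ (41∕140)² ≤ c²
  have hjk : 24 * (j : ℝ) ≤ k := by nlinarith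
  have h12 : 2 * (j : ℝ) / k ≤ 1 / 12 := by rw [div_le_iff₀ hkr]; linarith
  have hA0 : 0 ≤ ((41 : ℝ) / 140) ^ 2 - 2 * (j : ℝ) / k := by nlinarith
  -- c(c² − 2j∕k) ≥ (41∕140)((41∕140)² − 2j∕k)
  have hmono : ((41 : ℝ) / 140) * (((41 : ℝ) / 140) ^ 2 - 2 * (j : ℝ) / k) ≤ c * (c ^ 2 - 2 * (j : ℝ) / k) := by
    have h1 : ((41 : ℝ) / 140) ^ 2 - 2 * (j : ℝ) / k ≤ c ^ 2 - 2 * (j : ℝ) / k := by nlinarith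
    calc ((41 : ℝ) / 140) * (((41 : ℝ) / 140) ^ 2 - 2 * (j : ℝ) / k) ≤ ((41 : ℝ) / 140) * (c ^ 2 - 2 * (j : ℝ) / k) :=
          mul_le_mul_of_nonneg_left h1 (by norm_num)
      _ ≤ c * (c ^ 2 - 2 * (j : ℝ) / k) := mul_le_mul_of_nonneg_right hc0 (by linarith)
  -- the rational core: (41∕140)³ − (41∕140)(2j∕k) − 2i∕j − 2i∕k ≥ 0  ⟸  jk ≥ 80(ik+ij) + 24j²
  have hcore : 0 ≤ ((41 : ℝ) / 140) * (((41 : ℝ) / 140) ^ 2 - 2 * (j : ℝ) / k) - 2 * (i : ℝ) / j - 2 * (i : ℝ) / k := by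
    have hjk0 : (0 : ℝ) < (j : ℝ) * k := mul_pos hjr hkr
    have e : ((41 : ℝ) / 140) * (((41 : ℝ) / 140) ^ 2 - 2 * (j : ℝ) / k) - 2 * (i : ℝ) / j - 2 * (i : ℝ) / k
        = (((41 : ℝ) / 140) ^ 3 * (j * k) - 2 * (41 / 140) * (j * j) - 2 * (i * k) - 2 * (i * j)) / (j * k) := by
      field_simp
    rw [e]
    exact div_nonneg (by nlinarith) hjk0.le
  have e3 : c ^ 3 - c * (2 * (j : ℝ) / k) = c * (c ^ 2 - 2 * (j : ℝ) / k) := by ring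
  rw [e3]
  linarith

/-! ## §2 The hierarchical three-age END along flows -/

/-- **THREE AGES `i ≪ j ≪ k`: THE END ALONG EVERY FLOW WITH NO DISPLAYED MARGIN — EVERY HORIZON, EVERY DAMPING OF THE SELF-CONSISTENT CLASS, WHATEVER
THE TOTAL LOAD.**  For the isotone dominated memory with floor and the profile carried by `{i, j, k}` (`1 ≤ i < j < k < K`, `L_l = 0` for the other
ages `< K`) with `80·(ik + ij) + 24·j² ≤ j·k`, dampings with `g_t(1 + F_t) ≥ 1`: the comparison surplus of every admissible excess satisfies
`0 ≤ ε ≤ e` at every pin (§1 `residual_step` twice: the middle read against the old one over `d ≤ j` pins, then the young read against both over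
`d ≤ i` pins; (E91a) `old_read_variation`; loads `≤ √2∕2`; `nested_numerics`). [folklore] -/
theorem flow_nonneg_three_ages_nested (hmono : ∀ u v : ℕ → ℝ, SeqBox γ u → SeqBox γ v → (∀ j, u j ≤ v j) → B u ≤ B v)
    (hL : ∀ k, 0 ≤ L k) (hb : 0 < b) (hlo : ∀ u, SeqBox γ u → b ≤ B u) (hdom : ∀ u, SeqBox γ u → ∑ k ∈ range K, L k * u k ≤ B u)
    (hh : SeqBox γ h) (hf : MemFlow B gIR h) (hg : ∀ t, 0 < g t ∧ g t ≤ 1)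
    (hgF : ∀ t, 1 ≤ g t * (1 + ∑ k ∈ range K, L k * h (t + k) ^ 3 / 2))
    {i j k : ℕ} (hi : 1 ≤ i) (hij : i < j) (hjk : j < k) (hkK : k < K) (hL3 : ∀ l, l < K → l ≠ i → l ≠ j → l ≠ k → L l = 0)
    (hcond : 80 * (i * k + i * j) + 24 * j * j ≤ j * k)
    {N : ℕ} {KL : ℕ → ℕ → ℕ → ℝ}
    (hKL : ∀ k n l, KL k n l = if 0 < k ∧ k < K ∧ l < k then L k * h (n + k) ^ 3 / 2 * ∏ t ∈ Ico (n + 1 + l) (n + k + 1), g t else 0)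
    {KA : ℕ → ℕ → ℕ → ℝ} {RA : ℕ → (ℕ → ℝ) → ℕ → ℝ}
    (hRA : ∀ i v m, RA i v m = ∑ l ∈ range K, KA i m l * v (m + 1 + l))
    (hKA : ∀ i m l, KA i m l = KL i m l + KA (i + 1) m l) (hKAtop : ∀ m l, KA K m l = 0)
    {e ε : ℕ → ℝ} (he0 : ∀ m, 0 ≤ e m) (hea : ∀ m, e (m + 1) ≤ e m)
    (hεt : ∀ m, N < m → ε m = 0) (hεrec : ∀ m, ε m = e m - RA 1 ε m) : ∀ m, 0 ≤ ε m ∧ ε m ≤ e m := by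
  have hpos : ∀ n, 0 < h n := fun n => (hh n).1
  have hiK : i < K := by omega
  have hjK : j < K := by omega
  have hj : 0 < j := by omega
  have hk : 0 < k := by omega
  have hK : 1 ≤ K := by omega
  have hL0 : L 0 = 0 := hL3 0 (by omega) (by omega) (by omega) (by omega)
  have hs2 : Real.sqrt 2 ^ 2 = 2 := Real.sq_sqrt (by norm_num)
  have hs0 : 0 ≤ Real.sqrt 2 := Real.sqrt_nonneg 2
  have hs17 : Real.sqrt 2 ≤ 17 / 12 := Real.sqrt_le_iff.mpr ⟨by norm_num, by norm_num⟩
  have hnum := nested_numerics (by omega) hj hk hcond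
  have hea' : ∀ p q, p ≤ q → e q ≤ e p := by
    intro p q hpq
    induction q, hpq using Nat.le_induction with
    | base => exact le_rfl
    | succ q _ ih => exact (hea q).trans ih
  -- the aggregate row is the young row plus the middle row plus the old row
  have hKA1 : ∀ m l, KA 1 m l = KL i m l + (KL j m l + KL k m l) := by
    intro m l
    have h1 : KA 1 m l = ∑ k' ∈ Ico 1 (K - 1 + 1), KL k' m l :=
      aggregate_eq_sum (n := K - 1) hKA (fun m l => by rw [Nat.sub_add_cancel hK]; exact hKAtop m l) (show 1 ≤ K - 1 + 1 by omega) m l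
    rw [h1, Nat.sub_add_cancel hK]
    have hsub : ({i, j, k} : Finset ℕ) ⊆ Ico 1 K := by
      intro x hx
      simp only [mem_insert, mem_singleton] at hx
      rw [mem_Ico]; rcases hx with rfl | rfl | rfl <;> omega
    rw [← sum_subset hsub (fun x hx hxn => by
      simp only [mem_insert, mem_singleton, not_or] at hxn
      rw [hKL]
      split_ifs
      · rw [hL3 x (mem_Ico.mp hx).2 hxn.1 hxn.2.1 hxn.2.2]; simp
      · rfl), sum_insert (by simp only [mem_insert, mem_singleton]; omega), sum_pair (by omega)]
  -- the recursion with the three reads displayed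
  have hrec3 : ∀ p, ε p = e p - ∑ l ∈ range K, KL i p l * ε (p + 1 + l)
      - (∑ l ∈ range K, KL j p l * ε (p + 1 + l) + ∑ l ∈ range K, KL k p l * ε (p + 1 + l)) := by
    intro p
    rw [hεrec p, hRA]
    have : ∑ l ∈ range K, KA 1 p l * ε (p + 1 + l) = ∑ l ∈ range K, KL i p l * ε (p + 1 + l)
        + (∑ l ∈ range K, KL j p l * ε (p + 1 + l) + ∑ l ∈ range K, KL k p l * ε (p + 1 + l)) := by
      rw [← sum_add_distrib, ← sum_add_distrib]; exact sum_congr rfl fun l _ => by rw [hKA1]; ring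
    rw [this]; ring
  refine renewal_bounds_of_step he0 hεt fun m IH => ?_
  -- non-negativity of every read at every pin `p ≥ m`
  have hread0 : ∀ a p, m ≤ p → 0 ≤ ∑ l ∈ range K, KL a p l * ε (p + 1 + l) := fun a p hp =>
    sum_nonneg fun l _ => mul_nonneg (kernel_entry_le hL hh hg hKL a p l).1 (IH _ (by omega)).1
  -- every read at the pin is at most its load times `e_m`, and the load is at most `√2∕2`
  have hreadle : ∀ {a : ℕ}, a < K → ∑ l ∈ range K, KL a m l * ε (m + 1 + l) ≤ (a : ℝ) * (L a * h (m + a) ^ 3 / 2) * e m := by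
    intro a haK
    calc ∑ l ∈ range K, KL a m l * ε (m + 1 + l) ≤ ∑ l ∈ range K, KL a m l * e m :=
          sum_le_sum fun l _ => mul_le_mul_of_nonneg_left
            (((IH _ (by omega)).2).trans (hea' m (m + 1 + l) (by omega))) (kernel_entry_le hL hh hg hKL a m l).1
      _ = (∑ l ∈ range K, KL a m l) * e m := by rw [sum_mul]
      _ ≤ (a : ℝ) * (L a * h (m + a) ^ 3 / 2) * e m := mul_le_mul_of_nonneg_right (row_mass_le hL hh hg hKL haK m) (he0 m)
  have hxj := window_load_le_sqrt_two_div_two hmono hL hb hlo hdom hh hf hjK m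
  have hxk := window_load_le_sqrt_two_div_two hmono hL hb hlo hdom hh hf hkK m
  have hxi := window_load_le_sqrt_two_div_two hmono hL hb hlo hdom hh hf hiK m
  set cj := L j * h (m + j) ^ 3 / 2 with hcj_def
  set ck := L k * h (m + k) ^ 3 / 2 with hck_def
  have hcj0 : 0 ≤ cj := by have := hL j; have := hpos (m + j); positivity
  have hck0 : 0 ≤ ck := by have := hL k; have := hpos (m + k); positivity
  have hem := he0 m
  have hjr : (0 : ℝ) < j := by exact_mod_cast hj
  have hkr : (0 : ℝ) < k := by exact_mod_cast hk
  have hir : (1 : ℝ) ≤ i := by exact_mod_cast hi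
  -- STEP 1 (old residual): e − O ≥ (1 − x_k)·e ≥ (1 − √2∕2)·e ≥ 0
  have hOle : ∑ l ∈ range K, KL k m l * ε (m + 1 + l) ≤ (k : ℝ) * ck * e m := hreadle hkK
  have hres1 : (1 - Real.sqrt 2 / 2) * e m ≤ e m - ∑ l ∈ range K, KL k m l * ε (m + 1 + l) := by
    have := mul_le_mul_of_nonneg_right hxk hem
    linarith
  have hc0 : 0 ≤ 1 - Real.sqrt 2 / 2 := by linarith [hs17]
  have hres1' : 0 ≤ e m - ∑ l ∈ range K, KL k m l * ε (m + 1 + l) := le_trans (mul_nonneg hc0 hem) hres1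
  -- (√2∕2)·(4n·c) ≤ 2n∕a whenever a·c ≤ √2∕2 (the loads are ≤ √2∕2)
  have hload : ∀ {n : ℕ} {a c : ℝ}, 0 < a → a * c ≤ Real.sqrt 2 / 2 → Real.sqrt 2 / 2 * (4 * n * c) ≤ 2 * (n : ℝ) / a := by
    intro n a c ha hac
    rw [le_div_iff₀ ha]
    have t := mul_le_mul_of_nonneg_left hac (show (0 : ℝ) ≤ Real.sqrt 2 / 2 * (4 * n) by positivity)
    have e1 : Real.sqrt 2 / 2 * (4 * (n : ℝ)) * (Real.sqrt 2 / 2) = 2 * n := by linear_combination (n : ℝ) * hs2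
    calc Real.sqrt 2 / 2 * (4 * n * c) * a = Real.sqrt 2 / 2 * (4 * (n : ℝ)) * (a * c) := by ring
      _ ≤ Real.sqrt 2 / 2 * (4 * (n : ℝ)) * (Real.sqrt 2 / 2) := t
      _ = 2 * n := e1
  -- STEP 2 (middle against old): the targets of the middle age carry the old read; the old read varies by ≤ 4j·c_k·e over d ≤ j pins
  have hstep2 := residual_step (i := j) (Kw := K) (m := m) (sy := Real.sqrt 2 / 2) (V := 4 * j * ck)
    (wy := fun l => KL j m l) (O := fun p => ∑ l ∈ range K, KL k p l * ε (p + 1 + l)) (e := e) (ε := ε)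
    (fun l => (kernel_entry_le hL hh hg hKL j m l).1) (fun l hl => by rw [hKL, if_neg (by omega)])
    ((row_mass_le hL hh hg hKL hjK m).trans hxj) (by positivity) he0 hea
    (fun q hq => by
      have := hrec3 q
      have h1 := hread0 i q hq.le
      have h2 := hread0 j q hq.le
      linarith)
    hres1'
    (fun d hd1 hdj => by
      have hdk : d ≤ k := by omega
      have hv := old_read_variation hmono hL hb hlo hdom hh hf hL0 hg hgF hKL hk hkK hd1 hdk he0 hea IH
      have hdr : (d : ℝ) ≤ j := by exact_mod_cast hdj
      have h4 : 4 * (d : ℝ) * ck * e m ≤ 4 * j * ck * e m := by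
        have := mul_le_mul_of_nonneg_right hdr (mul_nonneg hck0 hem)
        linarith
      exact hv.trans h4)
  -- the middle residual: e − O − M ≥ [(1 − √2∕2)² − 2j∕k]·e ≥ 0
  have hres2 : ((1 - Real.sqrt 2 / 2) ^ 2 - 2 * (j : ℝ) / k) * e m
      ≤ e m - (∑ l ∈ range K, KL j m l * ε (m + 1 + l) + ∑ l ∈ range K, KL k m l * ε (m + 1 + l)) := by
    have h1 : (1 - Real.sqrt 2 / 2) * ((1 - Real.sqrt 2 / 2) * e m) ≤ (1 - Real.sqrt 2 / 2) * (e m - ∑ l ∈ range K, KL k m l * ε (m + 1 + l)) :=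
      mul_le_mul_of_nonneg_left hres1 hc0
    have h3 : Real.sqrt 2 / 2 * (4 * j * ck) * e m ≤ 2 * (j : ℝ) / k * e m := mul_le_mul_of_nonneg_right (hload hkr hxk) hem
    linarith [hstep2, h1, h3]
  have hρ2 : 0 ≤ (1 - Real.sqrt 2 / 2) ^ 2 - 2 * (j : ℝ) / k := by
    have hc : (80 : ℝ) * (i * k + i * j) + 24 * j * j ≤ j * k := by exact_mod_cast hcond
    have hjk24 : 24 * (j : ℝ) ≤ k := by nlinarith
    have h12 : 2 * (j : ℝ) / k ≤ 1 / 12 := by rw [div_le_iff₀ hkr]; linarith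
    have h7 : (7 : ℝ) / 24 ≤ 1 - Real.sqrt 2 / 2 := by linarith [hs17]
    have h49 : ((7 : ℝ) / 24) ^ 2 ≤ (1 - Real.sqrt 2 / 2) ^ 2 := pow_le_pow_left₀ (by norm_num) h7 2
    nlinarith [h49, h12]
  have hres2' : 0 ≤ e m - (∑ l ∈ range K, KL j m l * ε (m + 1 + l) + ∑ l ∈ range K, KL k m l * ε (m + 1 + l)) :=
    le_trans (mul_nonneg hρ2 hem) hres2
  -- STEP 3 (young against both): the young targets carry both older reads; both vary slowly over d ≤ i pins
  have hstep3 := residual_step (i := i) (Kw := K) (m := m) (sy := Real.sqrt 2 / 2) (V := 4 * i * (cj + ck))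
    (wy := fun l => KL i m l)
    (O := fun p => ∑ l ∈ range K, KL j p l * ε (p + 1 + l) + ∑ l ∈ range K, KL k p l * ε (p + 1 + l)) (e := e) (ε := ε)
    (fun l => (kernel_entry_le hL hh hg hKL i m l).1) (fun l hl => by rw [hKL, if_neg (by omega)])
    ((row_mass_le hL hh hg hKL hiK m).trans hxi) (by positivity) he0 hea
    (fun q hq => by
      have := hrec3 q
      have h1 := hread0 i q hq.le
      linarith)
    hres2'
    (fun d hd1 hdi => by
      have hdj : d ≤ j := by omega
      have hdk : d ≤ k := by omega
      have hvj := old_read_variation hmono hL hb hlo hdom hh hf hL0 hg hgF hKL hj hjK hd1 hdj he0 hea IH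
      have hvk := old_read_variation hmono hL hb hlo hdom hh hf hL0 hg hgF hKL hk hkK hd1 hdk he0 hea IH
      have hdr : (d : ℝ) ≤ i := by exact_mod_cast hdi
      have h4 : 4 * (d : ℝ) * cj * e m + 4 * (d : ℝ) * ck * e m ≤ 4 * i * (cj + ck) * e m := by
        have := mul_le_mul_of_nonneg_right hdr (mul_nonneg (add_nonneg hcj0 hck0) hem)
        linarith
      rw [← hcj_def] at hvj
      rw [← hck_def] at hvk
      linarith [hvj, hvk, h4])
  -- assemble: ε_m = e − Y − (M + O) ≥ (1 − √2∕2)·(middle residual) − (√2∕2)·4i(c_j + c_k)·e ≥ nested_numerics · e ≥ 0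
  have hεm : ε m = e m - ∑ l ∈ range K, KL i m l * ε (m + 1 + l)
      - (∑ l ∈ range K, KL j m l * ε (m + 1 + l) + ∑ l ∈ range K, KL k m l * ε (m + 1 + l)) := hrec3 m
  refine ⟨?_, ?_⟩
  · have h1 : (1 - Real.sqrt 2 / 2) * (((1 - Real.sqrt 2 / 2) ^ 2 - 2 * (j : ℝ) / k) * e m)
        ≤ (1 - Real.sqrt 2 / 2) * (e m - (∑ l ∈ range K, KL j m l * ε (m + 1 + l) + ∑ l ∈ range K, KL k m l * ε (m + 1 + l))) :=
      mul_le_mul_of_nonneg_left hres2 hc0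
    have h2 : Real.sqrt 2 / 2 * (4 * i * (cj + ck)) ≤ 2 * (i : ℝ) / j + 2 * (i : ℝ) / k := by
      have hj' := hload (n := i) hjr hxj
      have hk' := hload (n := i) hkr hxk
      linarith
    have h3 : Real.sqrt 2 / 2 * (4 * i * (cj + ck)) * e m ≤ (2 * (i : ℝ) / j + 2 * (i : ℝ) / k) * e m :=
      mul_le_mul_of_nonneg_right h2 hem
    have h4 : 0 ≤ ((1 - Real.sqrt 2 / 2) ^ 3 - (1 - Real.sqrt 2 / 2) * (2 * (j : ℝ) / k) - 2 * (i : ℝ) / j - 2 * (i : ℝ) / k) * e m :=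
      mul_nonneg hnum hem
    rw [hεm]
    linarith [hstep3, h1, h3, h4]
  · rw [hεm]
    linarith [hread0 i m le_rfl, hread0 j m le_rfl, hread0 k m le_rfl]

/-- **THE CENSUS THREE AGES IN THE HIERARCHICAL WEDGE: `{1, k₂, k₃}` WITH `80(k₂ + k₃) + 24k₂² ≤ k₂k₃` — NO DISPLAYED MARGIN.**  (E.g. `k₂ ≥ 100`,
`k₃ ≥ 124k₂`; `k₂ ≥ 200`, `k₃ ≥ 41k₂`; `k₂ ≥ 1000`, `k₃ ≥ 27k₂`.)  `0 ≤ ε ≤ e` for every admissible excess, every horizon, every damping of the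
self-consistent class, whatever `d + x₂ + x₃` (`flow_nonneg_three_ages_nested` with `i = 1`). [folklore] -/
theorem flow_nonneg_census_three_ages_nested (hmono : ∀ u v : ℕ → ℝ, SeqBox γ u → SeqBox γ v → (∀ j, u j ≤ v j) → B u ≤ B v)
    (hL : ∀ k, 0 ≤ L k) (hb : 0 < b) (hlo : ∀ u, SeqBox γ u → b ≤ B u) (hdom : ∀ u, SeqBox γ u → ∑ k ∈ range K, L k * u k ≤ B u)
    (hh : SeqBox γ h) (hf : MemFlow B gIR h) (hg : ∀ t, 0 < g t ∧ g t ≤ 1)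
    (hgF : ∀ t, 1 ≤ g t * (1 + ∑ k ∈ range K, L k * h (t + k) ^ 3 / 2))
    {k₂ k₃ : ℕ} (hk2 : 2 ≤ k₂) (hk23 : k₂ < k₃) (hk3K : k₃ < K) (hL3 : ∀ j, j < K → j ≠ 1 → j ≠ k₂ → j ≠ k₃ → L j = 0)
    (hcond : 80 * (k₃ + k₂) + 24 * k₂ * k₂ ≤ k₂ * k₃)
    {N : ℕ} {KL : ℕ → ℕ → ℕ → ℝ}
    (hKL : ∀ k n l, KL k n l = if 0 < k ∧ k < K ∧ l < k then L k * h (n + k) ^ 3 / 2 * ∏ t ∈ Ico (n + 1 + l) (n + k + 1), g t else 0)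
    {KA : ℕ → ℕ → ℕ → ℝ} {RA : ℕ → (ℕ → ℝ) → ℕ → ℝ}
    (hRA : ∀ i v m, RA i v m = ∑ l ∈ range K, KA i m l * v (m + 1 + l))
    (hKA : ∀ i m l, KA i m l = KL i m l + KA (i + 1) m l) (hKAtop : ∀ m l, KA K m l = 0)
    {e ε : ℕ → ℝ} (he0 : ∀ m, 0 ≤ e m) (hea : ∀ m, e (m + 1) ≤ e m)
    (hεt : ∀ m, N < m → ε m = 0) (hεrec : ∀ m, ε m = e m - RA 1 ε m) : ∀ m, 0 ≤ ε m ∧ ε m ≤ e m :=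
  flow_nonneg_three_ages_nested hmono hL hb hlo hdom hh hf hg hgF (i := 1) le_rfl (by omega) hk23 hk3K hL3 (by simpa using hcond)
    hKL hRA hKA hKAtop he0 hea hεt hεrec

end Summit.QuantumFields.BalabanUV.Beta.EriceRemainderEnclosureHistoryAutonomyComparisonAgeCompositionNestedReads

end
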